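/-
Copyright (c) 2026. All rights reserved.
Released under Apache 2.0 license as described in the file LICENSE.
Authors: abc-iut cell, F-wave prover seat abc-iut-f-101 (gen 4), over abc-iut-w6-d036's genuine mono-analytic base
(`MLFGaloisMonoAnabelianContainers.lean`), abc-iut-L6-d2's `unitGroup` / `log_k̄` for every `MLFClosure`
(`GaloisPadicLogPerfection.lean`, `GaloisPadicLogMLF.lean`) and abc-iut-L4-t9's model category `𝒞_TS`.
-/
import Literature.AnabelianGeometry.AbsoluteAnabelian.AbsTopIII.MLFGaloisMonoAnabelianContainers
import Literature.AnabelianGeometry.AbsoluteAnabelian.GaloisPadicLogMLF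
import HarnessLib

/-!
# [AbsTopIII] Prop 5.8 (ii) AT THE GENUINE MONO-ANALYTIC BASE: the PERFECTION vertices `k~(G) = (𝒪^×_k̄(G))^pf` and
# `(k̄^×(G))^pf` of `Γ⃗×_non(G)` as `TS`-pairs of mono-analytic type (carriers, Galois actions, faithfulness)

S. Mochizuki, *Topics in absolute anabelian geometry III: global reconstruction algorithms*, J. Math. Sci. Univ.
Tokyo 22 (2015) 939–1156 [MochizukiAbsTopIII2015]; locators = pages of the author's manuscript
(`paper:url-5493eb38cbb7`), read on the page: Def 3.1 (i) p. 66 ("`k~ := (𝒪^×_k̄)^pf`", "pf" = perfection; for the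
divisible groups `𝒪^×_k̄`, `k̄^×` the perfection is the quotient by the roots of unity — abc-iut-L6-d2's
`GaloisPadicLogPerfection.lean`, abc-iut-L4-t9's `TimesPfCarrier = ℚ̄_pˣ ⧸ μ`), Def 3.1 (ii) p. 67 ("of mono-analytic
type": the arithmetic Galois group is the whole group, i.e. the action is FAITHFUL), Def 3.1 (iv) p. 69 (`λ^{×pf}`),
Prop 5.8 (ii) p. 139 ("a functorial [i.e., relative to `TG⊢`] “group-theoretic” algorithm “`G ↦ Γ⃗×_non(G)`”").

## What this file builds (node [AbsTopIII] Prop 5.8 (vii)/(ii), layer L4; L4-lead m88 row «PF-CARRIERS», part 1 of 2)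

abc-iut-w6-d036's `MLFGaloisMonoAnabelianContainers.lean` realises the vertices `𝒪^×`, `k̄^×` of `Γ⃗×_non(G)` on the genuine
mono-analytic base and leaves the two PERFECTION vertices "represented by their sources"
(`LogFrobeniusMonoGenuineProp58vii.lean`, HONEST LIMIT L1).  Here, in the SAME conventions (discrete arithmetic data,
Rmk 3.1.1; explicit `MulAction` defs, no instances):

* **faithfulness** (`algEquiv_eq_one_of_forall_unitSubmonoid_div_pow_eq_one`): `G_k` acts FAITHFULLY on `𝒪^×_k̄ ⧸ μ` —
  for EVERY `MLFClosure`, from the four axioms of `log_k̄` alone (abc-iut-L6-d2's `MLFClosure.galoisPadicLog`): if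
  `σ(u)/u` is a root of unity then `log(σ u) = log u`, i.e. `σ` fixes `log u`, and `log_k̄ : 𝒪^×_k̄ → k̄` is onto; hence
  also on `k̄^× ⧸ μ` (abc-iut-L4-t9's `PadicAlgCl.algEquiv_eq_refl_of_forall_div_pow_eq_one` for `ℚ̄_p/ℚ_p`, now general);
* carriers `MLFClosure.TimesPf C = (C.K)ˣ ⧸ μ` and `MLFClosure.UnitsPf C = 𝒪^×_k̄ ⧸ μ` (`μ` = the torsion subgroup;
  `UnitsPf C` is verbatim the domain of abc-iut-L6-d2's `MLFClosure.logEquiv : k~ ⥲ k̄`, `TimesPf C` is abc-iut-L4-t9's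
  `TimesPfCarrier` when `C.K = ℚ̄_p`), the Galois actions `timesPfAction`, `unitsPfAction` (`σ · [u] = [σ u]`);
* `MLFClosure.timesPfObj C = (G_k ↷ (k̄^×)^pf)`, `MLFClosure.unitsPfObj C = (G_k ↷ k~)` in `𝒞_TS`, BOTH OF MONO-ANALYTIC TYPE
  (`timesPfObj_actionKer`, `unitsPfObj_actionKer`).

Continued in `MLFGaloisMonoAnabelianPerfections.lean` (the FUNCTORS `kbarTimesPf`, `kbarUnitsPf : MonoBase ⥤ 𝒞_TS` with the
LCFT transport descended, and the three perfection edges of `Γ⃗×_non(G)`).  HONEST FRAMING: MODEL-LEVEL (one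
nonarchimedean place; arithmetic data discrete per Rmk 3.1.1); the `p`-adic logarithm as proved in the tree; refereed
pre-IUT material; nothing here bears on [IUTchIII] Cor. 3.12; no side taken; typed ≠ proved.
-/

set_option autoImplicit false

noncomputable section

namespace Literature.AnabelianGeometry.AbsoluteAnabelian

open CategoryTheory
open AbsTopIII
open scoped nonZeroDivisors

namespace MLFClosure

/-! ## Part 1. `G_k` acts faithfully on `𝒪^×_k̄ ⧸ μ` (every `MLFClosure`; from the axioms of `log_k̄`) -/

section Faithful

variable (C : MLFClosure.{0})

/-- `log_k̄ (x⁻¹) = - log_k̄ x` on `𝒪^×_k̄` (from `log_mul` and `log 1 = 0`).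
[cite: MochizukiAbsTopIII2015, Definition 3.1 (i) p.66] -/
theorem galoisPadicLog_log_inv (L : GaloisPadicLog C.k C.K) {x : C.K} (hx : x ∈ unitSubmonoid C.k C.K) :
    L.log x⁻¹ = -L.log x := by
  have hx0 : x ≠ 0 := AbsoluteAnabelian.ne_zero_of_mem_unitSubmonoid hx
  have h1 : L.log 1 = 0 := L.log_eq_zero_of_pow_eq_one (unitSubmonoid C.k C.K).one_mem one_pos (one_pow 1)
  have h := L.log_mul x hx x⁻¹ (AbsoluteAnabelian.inv_mem_unitSubmonoid hx)
  rw [mul_inv_cancel₀ hx0, h1] at h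
  linear_combination -h

/-- **`G_k` acts FAITHFULLY on `k~ = 𝒪^×_k̄ ⧸ μ`** (the reason `(G_k ↷ k~)` is a pair of mono-analytic type, Def 3.1
(i)/(ii)): if `σ(x)/x` is a root of unity for every `x ∈ 𝒪^×_k̄`, then `σ = 1`.  Proof from the four axioms of `log_k̄`
(abc-iut-L6-d2's `MLFClosure.galoisPadicLog`, every `MLFClosure`): `log (σ x / x) = 0`, so `σ (log x) = log (σ x) = log x`,
and `log_k̄ : 𝒪^×_k̄ → k̄` is onto. [cite: MochizukiAbsTopIII2015, Definition 3.1 (i) p.66] -/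
theorem algEquiv_eq_one_of_forall_unitSubmonoid_div_pow_eq_one (σ : C.K ≃ₐ[C.k] C.K)
    (h : ∀ x ∈ unitSubmonoid C.k C.K, ∃ n : ℕ, 0 < n ∧ (σ x / x) ^ n = 1) : σ = 1 := by
  let L := C.galoisPadicLog
  apply AlgEquiv.ext
  intro y
  obtain ⟨x, hx, rfl⟩ := L.log_surjective y
  have hx0 : x ≠ 0 := AbsoluteAnabelian.ne_zero_of_mem_unitSubmonoid hx
  have hσx : σ x ∈ unitSubmonoid C.k C.K := by
    have := smul_mem_unitSubmonoid σ hx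
    rwa [AlgEquiv.smul_def] at this
  have hq : σ x / x ∈ unitSubmonoid C.k C.K := by
    rw [div_eq_mul_inv]
    exact (unitSubmonoid C.k C.K).mul_mem hσx (AbsoluteAnabelian.inv_mem_unitSubmonoid hx)
  obtain ⟨n, hn, hqn⟩ := h x hx
  have hlog0 : L.log (σ x / x) = 0 := (L.log_eq_zero_iff _ hq).mpr ⟨n, hn, hqn⟩
  have hlog : L.log (σ x) = L.log x := by
    rw [div_eq_mul_inv, L.log_mul _ hσx _ (AbsoluteAnabelian.inv_mem_unitSubmonoid hx), C.galoisPadicLog_log_inv L hx] at hlog0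
    linear_combination hlog0
  have hsmul := L.log_smul σ x hx
  rw [AlgEquiv.smul_def, AlgEquiv.smul_def, hlog] at hsmul
  rw [AlgEquiv.one_apply]
  exact hsmul.symm

/-- Hence `G_k` acts faithfully on `(k̄^×)^pf = k̄^× ⧸ μ` as well: if `σ(x)/x` is a root of unity for every `x ≠ 0`, then
`σ = 1` (abc-iut-L4-t9's `PadicAlgCl.algEquiv_eq_refl_of_forall_div_pow_eq_one`, now for every `MLFClosure`).
[cite: MochizukiAbsTopIII2015, Definition 3.1 (iv) p.69] -/
theorem algEquiv_eq_one_of_forall_ne_zero_div_pow_eq_one (σ : C.K ≃ₐ[C.k] C.K)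
    (h : ∀ x : C.K, x ≠ 0 → ∃ n : ℕ, 0 < n ∧ (σ x / x) ^ n = 1) : σ = 1 :=
  C.algEquiv_eq_one_of_forall_unitSubmonoid_div_pow_eq_one σ fun x hx => h x (AbsoluteAnabelian.ne_zero_of_mem_unitSubmonoid hx)

end Faithful

/-! ## Part 2. Torsion quotients: the carriers `(k̄^×)^pf`, `k~` and their Galois actions -/

/-- A homomorphism of commutative groups carries torsion into torsion (the reason the Galois action and the transports
descend to the perfections `k̄^× ⧸ μ`, `𝒪^×_k̄ ⧸ μ`; abc-iut-L4-t9's `torsion_le_comap_unitsGal` for a general homomorphism).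
[cite: MochizukiAbsTopIII2015, Definition 3.1 (iv) p.69] -/
theorem torsion_le_comap_of_monoidHom {G H : Type*} [CommGroup G] [CommGroup H] (f : G →* H) :
    CommGroup.torsion G ≤ (CommGroup.torsion H).comap f := fun x hx => by
  rw [Subgroup.mem_comap, CommGroup.mem_torsion]
  exact f.isOfFinOrder ((CommGroup.mem_torsion _).mp hx)

/-- **`(k̄^×)^pf`**, the perfection of the divisible group `k̄^×`, realised as the quotient by its torsion `μ` (abc-iut-L4-t9's
`TimesPfCarrier` convention). [cite: MochizukiAbsTopIII2015, Definition 3.1 (iv) p.69] -/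
abbrev TimesPf (C : MLFClosure.{0}) : Type := (C.K)ˣ ⧸ CommGroup.torsion (C.K)ˣ

/-- **`k~ := (𝒪^×_k̄)^pf`**, realised as `𝒪^×_k̄ ⧸ μ` (abc-iut-L6-d2's convention; the domain of `MLFClosure.logEquiv`).
[cite: MochizukiAbsTopIII2015, Definition 3.1 (i) p.66] -/
abbrev UnitsPf (C : MLFClosure.{0}) : Type := ↥(unitGroup C.k C.K) ⧸ CommGroup.torsion ↥(unitGroup C.k C.K)

/-- The quotient map `k̄^× → (k̄^×)^pf`. [cite: MochizukiAbsTopIII2015, Definition 3.1 (iv) p.69] -/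
abbrev toTimesPf (C : MLFClosure.{0}) : (C.K)ˣ →* TimesPf C := QuotientGroup.mk' _

/-- The quotient map `𝒪^×_k̄ → k~`. [cite: MochizukiAbsTopIII2015, Definition 3.1 (i) p.66] -/
abbrev toUnitsPf (C : MLFClosure.{0}) : ↥(unitGroup C.k C.K) →* UnitsPf C := QuotientGroup.mk' _

variable (C : MLFClosure.{0})

/-- Two elements of `k̄^×` agree in `(k̄^×)^pf` iff their quotient is a root of unity.
[cite: MochizukiAbsTopIII2015, Definition 3.1 (iv) p.69] -/
theorem toTimesPf_eq_iff (u v : (C.K)ˣ) :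
    toTimesPf C u = toTimesPf C v ↔ ∃ n : ℕ, 0 < n ∧ ((u : C.K) / v) ^ n = 1 := by
  rw [QuotientGroup.mk'_apply, QuotientGroup.mk'_apply, QuotientGroup.eq_iff_div_mem, CommGroup.mem_torsion,
    isOfFinOrder_iff_pow_eq_one]
  refine exists_congr fun n => and_congr_right fun _ => ?_
  rw [Units.ext_iff, Units.val_pow_eq_pow_val, Units.val_div_eq_div_val, Units.val_one]

/-- Two elements of `𝒪^×_k̄` agree in `k~` iff their quotient is a root of unity.
[cite: MochizukiAbsTopIII2015, Definition 3.1 (i) p.66] -/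
theorem toUnitsPf_eq_iff (u v : ↥(unitGroup C.k C.K)) :
    toUnitsPf C u = toUnitsPf C v ↔ ∃ n : ℕ, 0 < n ∧ (((u / v : ↥(unitGroup C.k C.K)) : (C.K)ˣ) : C.K) ^ n = 1 := by
  rw [QuotientGroup.mk'_apply, QuotientGroup.mk'_apply, QuotientGroup.eq_iff_div_mem, CommGroup.mem_torsion,
    isOfFinOrder_unitGroup_iff]

/-- `k̄^×` as units of the field versus as non-zero-divisors (abc-iut-w6-d036's carrier of `kbarTimes`).
[cite: MochizukiAbsTopIII2015, Definition 3.1 (i) p.67] -/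
def unitsOfNonZero (C : MLFClosure.{0}) : ↥(C.K)⁰ ≃* (C.K)ˣ where
  toFun x := Units.mk0 (x : C.K) (nonZeroDivisors.coe_ne_zero x)
  invFun u := ⟨(u : C.K), mem_nonZeroDivisors_of_ne_zero u.ne_zero⟩
  left_inv _ := rfl
  right_inv _ := Units.ext rfl
  map_mul' _ _ := Units.ext rfl

/-- `unitsOfNonZero` on values. [cite: MochizukiAbsTopIII2015, Definition 3.1 (i) p.67] -/
@[simp] theorem coe_unitsOfNonZero (x : ↥(C.K)⁰) : ((unitsOfNonZero C x : (C.K)ˣ) : C.K) = x := rfl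

/-- `unitsOfNonZero.symm` on values. [cite: MochizukiAbsTopIII2015, Definition 3.1 (i) p.67] -/
@[simp] theorem coe_unitsOfNonZero_symm (u : (C.K)ˣ) : (((unitsOfNonZero C).symm u : ↥(C.K)⁰) : C.K) = u := rfl

/-- `σ ∈ Gal(k̄/k)` on `k̄^×` (units of the field). [cite: MochizukiAbsTopIII2015, Definition 3.1 (i) p.67] -/
def galUnitsHom (σ : C.K ≃ₐ[C.k] C.K) : (C.K)ˣ →* (C.K)ˣ := Units.map (σ : C.K →* C.K)

/-- `galUnitsHom` on values. [cite: MochizukiAbsTopIII2015, Definition 3.1 (i) p.67] -/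
@[simp] theorem coe_galUnitsHom (σ : C.K ≃ₐ[C.k] C.K) (u : (C.K)ˣ) : ((C.galUnitsHom σ u : (C.K)ˣ) : C.K) = σ u := rfl

/-- `σ ∈ Gal(k̄/k)` on `𝒪^×_k̄` (abc-iut-L6-d2's `unitGroup_map_galois_mem`). [cite: MochizukiAbsTopIII2015, Definition 3.1 (i) p.66] -/
def galUnitGroupHom (σ : C.K ≃ₐ[C.k] C.K) : ↥(unitGroup C.k C.K) →* ↥(unitGroup C.k C.K) :=
  ((C.galUnitsHom σ).comp (unitGroup C.k C.K).subtype).codRestrict _ fun u => unitGroup_map_galois_mem σ u.2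

/-- `galUnitGroupHom` on values. [cite: MochizukiAbsTopIII2015, Definition 3.1 (i) p.66] -/
@[simp] theorem coe_galUnitGroupHom (σ : C.K ≃ₐ[C.k] C.K) (u : ↥(unitGroup C.k C.K)) :
    (((C.galUnitGroupHom σ u : ↥(unitGroup C.k C.K)) : (C.K)ˣ) : C.K) = σ ((u : (C.K)ˣ) : C.K) := rfl

/-- `σ` on `(k̄^×)^pf` (torsion descends: a homomorphism preserves finite order).
[cite: MochizukiAbsTopIII2015, Definition 3.1 (iv) p.69] -/
def galTimesPfHom (σ : C.K ≃ₐ[C.k] C.K) : TimesPf C →* TimesPf C :=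
  QuotientGroup.map _ _ (C.galUnitsHom σ) (torsion_le_comap_of_monoidHom _)

/-- `σ` on `k~`. [cite: MochizukiAbsTopIII2015, Definition 3.1 (i) p.66] -/
def galUnitsPfHom (σ : C.K ≃ₐ[C.k] C.K) : UnitsPf C →* UnitsPf C :=
  QuotientGroup.map _ _ (C.galUnitGroupHom σ) (torsion_le_comap_of_monoidHom _)

/-- `σ [u] = [σ u]` in `(k̄^×)^pf`. [cite: MochizukiAbsTopIII2015, Definition 3.1 (iv) p.69] -/
@[simp] theorem galTimesPfHom_mk (σ : C.K ≃ₐ[C.k] C.K) (u : (C.K)ˣ) :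
    C.galTimesPfHom σ (toTimesPf C u) = toTimesPf C (C.galUnitsHom σ u) := rfl

/-- `σ [u] = [σ u]` in `k~`. [cite: MochizukiAbsTopIII2015, Definition 3.1 (i) p.66] -/
@[simp] theorem galUnitsPfHom_mk (σ : C.K ≃ₐ[C.k] C.K) (u : ↥(unitGroup C.k C.K)) :
    C.galUnitsPfHom σ (toUnitsPf C u) = toUnitsPf C (C.galUnitGroupHom σ u) := rfl

/-- The action of `Gal(k̄/k)` on `(k̄^×)^pf`. [cite: MochizukiAbsTopIII2015, Definition 3.1 (iv) p.69] -/
@[reducible] def timesPfAction (C : MLFClosure.{0}) : MulAction (C.K ≃ₐ[C.k] C.K) (TimesPf C) where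
  smul σ x := C.galTimesPfHom σ x
  one_smul x := by
    induction x using QuotientGroup.induction_on with
    | H u =>
      change C.galTimesPfHom 1 (toTimesPf C u) = toTimesPf C u
      rw [galTimesPfHom_mk]
      exact congrArg (toTimesPf C) (Units.ext rfl)
  mul_smul σ τ x := by
    induction x using QuotientGroup.induction_on with
    | H u =>
      change C.galTimesPfHom (σ * τ) (toTimesPf C u) = C.galTimesPfHom σ (C.galTimesPfHom τ (toTimesPf C u))
      rw [galTimesPfHom_mk, galTimesPfHom_mk, galTimesPfHom_mk]
      exact congrArg (toTimesPf C) (Units.ext rfl)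

/-- The action of `Gal(k̄/k)` on `k~`. [cite: MochizukiAbsTopIII2015, Definition 3.1 (i) p.66] -/
@[reducible] def unitsPfAction (C : MLFClosure.{0}) : MulAction (C.K ≃ₐ[C.k] C.K) (UnitsPf C) where
  smul σ x := C.galUnitsPfHom σ x
  one_smul x := by
    induction x using QuotientGroup.induction_on with
    | H u =>
      change C.galUnitsPfHom 1 (toUnitsPf C u) = toUnitsPf C u
      rw [galUnitsPfHom_mk]
      exact congrArg (toUnitsPf C) (Subtype.ext (Units.ext rfl))
  mul_smul σ τ x := by
    induction x using QuotientGroup.induction_on with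
    | H u =>
      change C.galUnitsPfHom (σ * τ) (toUnitsPf C u) = C.galUnitsPfHom σ (C.galUnitsPfHom τ (toUnitsPf C u))
      rw [galUnitsPfHom_mk, galUnitsPfHom_mk, galUnitsPfHom_mk]
      exact congrArg (toUnitsPf C) (Subtype.ext (Units.ext rfl))

/-! ## Part 3. The `TS`-pairs `(G_k ↷ (k̄^×)^pf)` and `(G_k ↷ k~)`, of mono-analytic type -/

/-- Stabilisers in `(k̄^×)^pf` are open (they contain the Krull-open stabiliser of a lift).
[cite: MochizukiAbsTopIII2015, Definition 3.1 (i) p.67] -/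
theorem isOpen_stabilizer_timesPf (x : TimesPf C) :
    letI := timesPfAction C
    IsOpen (MulAction.stabilizer (C.K ≃ₐ[C.k] C.K) x : Set (C.K ≃ₐ[C.k] C.K)) := by
  letI := timesPfAction C
  induction x using QuotientGroup.induction_on with
  | H u =>
    refine Subgroup.isOpen_mono (H₁ := MulAction.stabilizer (C.K ≃ₐ[C.k] C.K) (u : C.K)) ?_
      (C.isOpen_stabilizer (u : C.K))
    intro σ hσ
    rw [MulAction.mem_stabilizer_iff] at hσ ⊢
    change C.galTimesPfHom σ (toTimesPf C u) = toTimesPf C u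
    rw [galTimesPfHom_mk]
    refine congrArg (toTimesPf C) (Units.ext ?_)
    rw [coe_galUnitsHom, ← AlgEquiv.smul_def]
    exact hσ

/-- Stabilisers in `k~` are open. [cite: MochizukiAbsTopIII2015, Definition 3.1 (i) p.67] -/
theorem isOpen_stabilizer_unitsPf (x : UnitsPf C) :
    letI := unitsPfAction C
    IsOpen (MulAction.stabilizer (C.K ≃ₐ[C.k] C.K) x : Set (C.K ≃ₐ[C.k] C.K)) := by
  letI := unitsPfAction C
  induction x using QuotientGroup.induction_on with
  | H u =>
    refine Subgroup.isOpen_mono (H₁ := MulAction.stabilizer (C.K ≃ₐ[C.k] C.K) ((u : (C.K)ˣ) : C.K)) ?_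
      (C.isOpen_stabilizer ((u : (C.K)ˣ) : C.K))
    intro σ hσ
    rw [MulAction.mem_stabilizer_iff] at hσ ⊢
    change C.galUnitsPfHom σ (toUnitsPf C u) = toUnitsPf C u
    rw [galUnitsPfHom_mk]
    refine congrArg (toUnitsPf C) (Subtype.ext (Units.ext ?_))
    rw [coe_galUnitGroupHom, ← AlgEquiv.smul_def]
    exact hσ

/-- **`(G_k ↷ (k̄^×)^pf)`** — the vertex `(k̄^×)^pf` of `Γ⃗×_non(G)` at `G = G_k` — as a `TS`-pair (arithmetic datum
discrete, Rmk 3.1.1). [cite: MochizukiAbsTopIII2015, Prop 5.8 (ii) p. 139] -/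
def timesPfPair (C : MLFClosure.{0}) : GaloisSpacePair.{0} :=
  letI : TopologicalSpace (TimesPf C) := ⊥
  haveI : DiscreteTopology (TimesPf C) := ⟨rfl⟩
  haveI : LocallyCompactSpace (TimesPf C) :=
    ⟨fun x _ hn => ⟨{x}, by rw [nhds_discrete]; exact Filter.mem_pure.2 rfl,
      Set.singleton_subset_iff.2 (mem_of_mem_nhds hn), isCompact_singleton⟩⟩
  letI : MulAction (C.K ≃ₐ[C.k] C.K) (TimesPf C) := timesPfAction C
  { Pi := C.K ≃ₐ[C.k] C.K
    M := TimesPf C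
    continuous_smul :=
      ((continuousSMul_iff_stabilizer_isOpen (M := C.K ≃ₐ[C.k] C.K) (X := TimesPf C)).2
        (C.isOpen_stabilizer_timesPf)).continuous_smul }

/-- **`(G_k ↷ k~)`** — the vertex `k~ = (𝒪^×_k̄)^pf` of `Γ⃗×_non(G)` at `G = G_k` — as a `TS`-pair.
[cite: MochizukiAbsTopIII2015, Prop 5.8 (ii) p. 139] -/
def unitsPfPair (C : MLFClosure.{0}) : GaloisSpacePair.{0} :=
  letI : TopologicalSpace (UnitsPf C) := ⊥
  haveI : DiscreteTopology (UnitsPf C) := ⟨rfl⟩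
  haveI : LocallyCompactSpace (UnitsPf C) :=
    ⟨fun x _ hn => ⟨{x}, by rw [nhds_discrete]; exact Filter.mem_pure.2 rfl,
      Set.singleton_subset_iff.2 (mem_of_mem_nhds hn), isCompact_singleton⟩⟩
  letI : MulAction (C.K ≃ₐ[C.k] C.K) (UnitsPf C) := unitsPfAction C
  { Pi := C.K ≃ₐ[C.k] C.K
    M := UnitsPf C
    continuous_smul :=
      ((continuousSMul_iff_stabilizer_isOpen (M := C.K ≃ₐ[C.k] C.K) (X := UnitsPf C)).2
        (C.isOpen_stabilizer_unitsPf)).continuous_smul }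

/-- `(G_k ↷ (k̄^×)^pf)` as an object of abc-iut-L4-t9's `𝒞_TS`. [cite: MochizukiAbsTopIII2015, Prop 5.8 (ii) p. 139] -/
def timesPfObj (C : MLFClosure.{0}) : TSObj := ⟨timesPfPair C⟩

/-- `(G_k ↷ k~)` as an object of `𝒞_TS`. [cite: MochizukiAbsTopIII2015, Prop 5.8 (ii) p. 139] -/
def unitsPfObj (C : MLFClosure.{0}) : TSObj := ⟨unitsPfPair C⟩

/-- The arithmetic datum of `(G_k ↷ (k̄^×)^pf)` IS `(k̄^×)^pf` and its Galois group IS `Gal(k̄/k)`.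
[cite: MochizukiAbsTopIII2015, Prop 5.8 (ii) p. 139] -/
theorem timesPfObj_M_Pi (C : MLFClosure.{0}) :
    (timesPfObj C).pair.M = TimesPf C ∧ (timesPfObj C).pair.Pi = (C.K ≃ₐ[C.k] C.K) := ⟨rfl, rfl⟩

/-- The arithmetic datum of `(G_k ↷ k~)` IS `k~` and its Galois group IS `Gal(k̄/k)`.
[cite: MochizukiAbsTopIII2015, Prop 5.8 (ii) p. 139] -/
theorem unitsPfObj_M_Pi (C : MLFClosure.{0}) :
    (unitsPfObj C).pair.M = UnitsPf C ∧ (unitsPfObj C).pair.Pi = (C.K ≃ₐ[C.k] C.K) := ⟨rfl, rfl⟩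

/-- The action in `(G_k ↷ (k̄^×)^pf)` on classes: `σ · [u] = [σ u]`. [cite: MochizukiAbsTopIII2015, Definition 3.1 (iv) p.69] -/
theorem timesPfObj_smul_mk (σ : (timesPfObj C).pair.Pi) (u : (C.K)ˣ) :
    σ • (show (timesPfObj C).pair.M from toTimesPf C u) =
      (show (timesPfObj C).pair.M from toTimesPf C (C.galUnitsHom (show C.K ≃ₐ[C.k] C.K from σ) u)) := rfl

/-- The action in `(G_k ↷ k~)` on classes: `σ · [u] = [σ u]`. [cite: MochizukiAbsTopIII2015, Definition 3.1 (i) p.66] -/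
theorem unitsPfObj_smul_mk (σ : (unitsPfObj C).pair.Pi) (u : ↥(unitGroup C.k C.K)) :
    σ • (show (unitsPfObj C).pair.M from toUnitsPf C u) =
      (show (unitsPfObj C).pair.M from toUnitsPf C (C.galUnitGroupHom (show C.K ≃ₐ[C.k] C.K from σ) u)) := rfl

/-- The arithmetic datum of `(G_k ↷ (k̄^×)^pf)` is discrete (Rmk 3.1.1 convention). [cite: MochizukiAbsTopIII2015, Remark 3.1.1 p.70] -/
theorem timesPfObj_discreteTopology (C : MLFClosure.{0}) : DiscreteTopology (timesPfObj C).pair.M := ⟨rfl⟩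

/-- The arithmetic datum of `(G_k ↷ k~)` is discrete. [cite: MochizukiAbsTopIII2015, Remark 3.1.1 p.70] -/
theorem unitsPfObj_discreteTopology (C : MLFClosure.{0}) : DiscreteTopology (unitsPfObj C).pair.M := ⟨rfl⟩

/-- **`(G_k ↷ (k̄^×)^pf)` is of mono-analytic type**: its action kernel is trivial (`G_k` acts faithfully on `k̄^× ⧸ μ`).
[cite: MochizukiAbsTopIII2015, Definition 3.1 (ii) p.67] -/
theorem timesPfObj_actionKer (C : MLFClosure.{0}) : (timesPfObj C).actionKer = ⊥ := by
  rw [eq_bot_iff]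
  intro σ hσ
  rw [TSObj.mem_actionKer_iff] at hσ
  rw [Subgroup.mem_bot]
  refine C.algEquiv_eq_one_of_forall_ne_zero_div_pow_eq_one (show C.K ≃ₐ[C.k] C.K from σ) fun x hx => ?_
  have h : toTimesPf C (C.galUnitsHom (show C.K ≃ₐ[C.k] C.K from σ) (Units.mk0 x hx)) = toTimesPf C (Units.mk0 x hx) :=
    hσ (show (timesPfObj C).pair.M from toTimesPf C (Units.mk0 x hx))
  exact (C.toTimesPf_eq_iff _ _).mp h

/-- **`(G_k ↷ k~)` is of mono-analytic type**: its action kernel is trivial (`G_k` acts faithfully on `𝒪^×_k̄ ⧸ μ`).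
[cite: MochizukiAbsTopIII2015, Definition 3.1 (ii) p.67] -/
theorem unitsPfObj_actionKer (C : MLFClosure.{0}) : (unitsPfObj C).actionKer = ⊥ := by
  rw [eq_bot_iff]
  intro σ hσ
  rw [TSObj.mem_actionKer_iff] at hσ
  rw [Subgroup.mem_bot]
  refine C.algEquiv_eq_one_of_forall_unitSubmonoid_div_pow_eq_one (show C.K ≃ₐ[C.k] C.K from σ) fun x hx => ?_
  obtain ⟨u, hu⟩ := exists_unitGroup_val_eq hx
  have h : toUnitsPf C (C.galUnitGroupHom (show C.K ≃ₐ[C.k] C.K from σ) u) = toUnitsPf C u :=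
    hσ (show (unitsPfObj C).pair.M from toUnitsPf C u)
  obtain ⟨n, hn, hpow⟩ := (C.toUnitsPf_eq_iff _ _).mp h
  refine ⟨n, hn, ?_⟩
  rw [Subgroup.coe_div, Units.val_div_eq_div_val, coe_galUnitGroupHom, hu] at hpow
  exact hpow

end MLFClosure

end Literature.AnabelianGeometry.AbsoluteAnabelian

end
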